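import Mathlib.Algebra.Order.BigOperators.Group.LocallyFinite
import Mathlib.FieldTheory.Finite.Extension
import Mathlib.FieldTheory.IsAlgClosed.AlgebraicClosure
import Mathlib.FieldTheory.Minpoly.Field
import Mathlib.GroupTheory.Perm.Fin
import Mathlib.LinearAlgebra.Vandermonde
import Mathlib.RingTheory.Polynomial.Resultant.Basic
import Mathlib.Tactic.ComputeDegree
import Mathlib.Tactic.ReduceModChar
import Literature.Barriers.Parity.FunctionFieldMobiusBias
import HarnessLib

/-!
# The Möbius (parity) bias of Bateman–Horn over `𝔽₃[u]`: proof of `FunctionFieldMobiusBias`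

Sibling proof file of `FunctionFieldMobiusBias.lean`: `FunctionFieldMobiusBias_holds` proves the
named fact `Literature.Barriers.Parity.FunctionFieldMobiusBias` (Conrad–Conrad–Gross 2008,
Example 6.10) — and, appended by the 2026-08-16 barrier audit (D-0021), the NARROWED catalogue
record `FunctionFieldMobiusBiasNarrow` (the one named fact of this file) together with its proof
`FunctionFieldMobiusBiasNarrow_holds`, see "Barrier audit" below. The fact proved first: for
`f(T) = T⁹ + (2u² + u)T⁶ + (2u + 2)T³ + u² + 2u + 1 ∈ 𝔽₃[u][T]` (`ccgPoly`) and every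
`g ∈ 𝔽₃[u]` with `deg g ≡ 1 (mod 4)`, `f(g)` is not irreducible in `𝔽₃[u]`.

## The printed proof and its transcription

CCG prove Example 6.10 from the Möbius formula (3.9),
`μ(f(g)) = (−1)ⁿ χ(−1)^{n(n−1)/2} χ(c)^{n+1} χ(g(1)² + g(1) + 2) χ(g(2))` (`g = cuⁿ + …`), which
rests on (2.5) `μ_{κ[u]}(h) = (−1)^{deg h} χ(disc h)` (Stickelberger–Swan, CCG Theorem 2.3) and on
the resultant formula (3.8) `R(f(g), (∂ᵤf)(g)) = c^{54n−6} (g(1)² + g(1) + 2)³ g(2)⁹`; for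
`n ≡ 1 (mod 4)` over `𝔽₃` this gives `μ(f(g)) = −1` only when `(f(g), (u−1)(u−2)) ≠ 1`, and
(6.5) `f(g)|_{u=1} = (g(1)−1)³(g(1)²+g(1)+2)³`, `f(g)|_{u=2} = g(2)⁶(g(2)+1)³`.

Mathlib has no Möbius function on `κ[u]`, so the argument is run directly on the hypothesis
"`h = f(g)` irreducible" with resultants (`Polynomial.resultant`), in three steps.

1. **Stickelberger–Swan parity, special case** (`resultant_derivative_of_irreducible`; CCG
   Theorem 2.3 / (2.5), Swan 1962): if `h ∈ 𝔽₃[u]` is irreducible of degree `d ≡ 1 (mod 4)`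
   then `Res_{d,n}(h, h′) = lead(h)^{d+n}` for every `n ≥ deg h′`. Proof (over
   `E = \overline{𝔽₃}`, monic case `prod_roots_eval_derivative`): the roots of `h` are the
   Frobenius conjugates `γ^{3^i}`, `i < d`, pairwise distinct (`minpoly ∣ X^{3^k} − X ⇒ d ∣ k`,
   Mathlib's `Irreducible.natDegree_dvd_of_dvd_X_pow_card_pow_sub_X`); `∏ᵢ h′(γᵢ) =
   (−1)^{d(d−1)/2} det(V)²` for the Vandermonde matrix `V` of the roots
   (`Finset.prod_prod_Ioi_mul_eq_prod_prod_off_diag`, `Matrix.det_vandermonde`); Frobenius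
   permutes the rows of `V` by the `d`-cycle `finRotate d`, which is even for `d` odd, so
   `det(V)³ = det(V) ≠ 0`, `det(V)² = 1`; and `d(d−1)/2` is even. (This is the computation of
   "the sign of a Galois-theoretic Frobenius as a permutation" of CCG's proof of Theorem 2.3.)
2. **The resultant formula** (`resultant_ccgPoly_derivative`; CCG Example 3.3, (3.8)): with
   `D = f(g)′ = (u+1)g⁶ + 2g³ + 2u + 2` (`derivative_ccgPoly_eval`), `m = deg g ≡ 1 (mod 4)`,
   `Res_{9m,6m+1}(f(g), D) = g(2)·(g(1)² + g(1) + 2)` in `𝔽₃`. This is (3.8) divided by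
   `lead(f(g))^{6m+1} = c` and reduced with `c² = 1`, `x³ = x` in `𝔽₃`; it is proved by the
   "recursive algebraic procedure" of CCG §3 (swap `Res(h₁,h₂) = ± Res(h₂,h₁)`,
   bimultiplicativity, quasi-periodicity `Res(M, h₁) = Res(M, h₂)` for `h₁ ≡ h₂ mod M`, all from
   `Mathlib.RingTheory.Polynomial.Resultant.Basic`) along the identities (characteristic `3`)
   `(g²−1)³·f(g) = g⁹(g²+g+2)³ − D²`, `D ≡ −g (mod g²−1)`, `D ≡ 2u+2 (mod g)`,
   `D ≡ (u+2)(g+1) (mod g²+g+2)`, giving `Res(D, g²−1) = −1`, `Res(D, g) = −g(2)`,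
   `Res(D, g²+g+2) = −(g(1)²+g(1)+2)`.
3. **Assembly** (`FunctionFieldMobiusBias_holds`; CCG Example 6.10): if `f(g)` were irreducible,
   step 1 gives `Res(f(g), D) = c^{9(15m+1)} = 1`, so `g(2)(g(1)²+g(1)+2) = 1`; but `f(g)` has no
   root in `𝔽₃` (`deg f(g) = 9m > 1`), and `f(g)(1) = 2g(1) + 1`, `f(g)(2) = g(2) + g(2)²`
   (the reductions of (6.5)), so `g(1) ≠ 1` and `g(2) = 1`, whence
   `g(2)(g(1)² + g(1) + 2) = 2` — a contradiction. (In Möbius language: these are exactly the `g`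
   with `(f(g), (u−1)(u−2)) = 1`, for which `μ(f(g)) = +1`.)

## Barrier audit (2026-08-16, D-0021): the record NARROWED

The catalogued fact is true (proved above) and its block was confirmed and sharpened by the same
day's audit of `FunctionFieldMobiusBias.lean`; the audit of THIS file narrows the SCOPE further and
records it as the companion fact `FunctionFieldMobiusBiasNarrow` (block in its docstring), PROVED
in place (`FunctionFieldMobiusBiasNarrow_holds`). In one sentence: the obstruction is carried entirely by
inseparability in `T` (`f ∈ κ[u][Tᵖ]`, the hypothesis of CCG Theorem 4.8), so only `f`-UNIFORM
transfers are blocked — for separable `F` Möbius cancellation along `F(g)` and, for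
`deg_T F = 2`, the naive Bateman–Horn asymptotic itself are THEOREMS over `𝔽_q[u]` for `q` large
relative to `p` (Sawin–Shusterman 2022, Theorems 1.2–1.3; `q → ∞`: Entin 2016), and the literal
analogue `T² + 1` of Conjecture E's polynomial is never an inseparable irreducible. New lemmas
(namespace `FunctionFieldMobiusBias`): `prod_roots_eval_derivative_of_four_dvd` (Stickelberger–Swan
parity for degree `≡ 0 (mod 4)`: the product of `h′` over the roots is `−1`, Frobenius being an
odd permutation), `not_irreducible_cube_add_X` (CCG Example 2.5 at `p = 3`: `g³ + u` is composite
for `4 ∣ deg g > 0`), `derivative_ccgPoly`, `derivative_cube_add_u` (both obstructed polynomials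
are inseparable), `derivative_ne_zero_of_irreducible_X_sq_add_one` (`T² + 1` irreducible ⇒
`∂_T(T² + 1) ≠ 0`, over any integral domain).

## References

* B. Conrad, K. Conrad, R. Gross, *Prime specialization in genus 0*, Trans. AMS 360 (2008),
  2867–2908: Theorem 2.3 and (2.5) (p. 2869–2870), Example 2.5 (p. 2871), Example 3.3 with
  (3.7)–(3.9) (p. 2872–2873), the five resultant rules of §3 (p. 2872), Theorem 4.8 (p. 2881),
  Theorem 5.12 (p. 2898), Conjecture 6.2 and Remark 6.3 (p. 2899–2901), Example 6.10 with
  (6.4)–(6.5) (p. 2903), Remark 6.11 and Theorem 6.12 (p. 2904) [ConradConradGross2008].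
* R. G. Swan, Factorization of polynomials over finite fields, *Pacific J. Math.* 12 (1962),
  1099–1106 (the discriminant/parity theorem behind (2.5); p. 1102, Example: `F(x)⁸ + x^m`,
  `m` odd, has an even number of irreducible factors in characteristic `2`) [Swan1962].
* W. Sawin, M. Shusterman, *Möbius cancellation on polynomial sequences and the quadratic
  Bateman–Horn conjecture over function fields*, Invent. math. 229 (2022), 751–927
  (arXiv:2008.09905): Conjecture 1.1, Theorem 1.2, Theorem 1.3 (pp. 3–5) [SawinShusterman2022].
* A. Entin, *On the Bateman–Horn conjecture for polynomials over large finite fields*, Compositio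
  Math. 152 (2016), 2525–2544 (arXiv:1409.0846): Theorem 1.1 and the remark after it
  [Entin2016].
* A. Bodin, P. Dèbes, S. Najib, *The Schinzel hypothesis for polynomials*, Trans. AMS 373 (2020),
  8339–8364 (arXiv:1902.08155): §1.2 (failure for `R = 𝔽₂`, Swan's `y⁸ + x³`)
  [BodinDebesNajib2020].
-/

noncomputable section

open Polynomial

namespace Literature.Barriers.Parity

namespace FunctionFieldMobiusBias

/-! ### Step 1: Stickelberger–Swan parity over `𝔽₃` (CCG Theorem 2.3 / (2.5), special case) -/

section Stickelberger

variable {E : Type*} [Field E] [Algebra (ZMod 3) E]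

/-- `h(x³) = h(x)³` for `h ∈ 𝔽₃[u]` and `x` in an extension of `𝔽₃` (Frobenius fixes the
coefficients). [folklore] -/
theorem eval_map_pow_three (h : (ZMod 3)[X]) (x : E) :
    (h.map (algebraMap (ZMod 3) E)).eval (x ^ 3) =
      ((h.map (algebraMap (ZMod 3) E)).eval x) ^ 3 := by
  rw [← expand_eval, ← map_expand, ZMod.expand_card, Polynomial.map_pow, eval_pow]

/-- The Frobenius conjugates `x^{3^i}` of a root `x` of `h ∈ 𝔽₃[u]` are roots of `h`. [folklore] -/
theorem isRoot_pow_three_pow {h : (ZMod 3)[X]} {x : E}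
    (hx : (h.map (algebraMap (ZMod 3) E)).IsRoot x) (i : ℕ) :
    (h.map (algebraMap (ZMod 3) E)).IsRoot (x ^ 3 ^ i) := by
  induction i with
  | zero => simpa using hx
  | succ i ih =>
    rw [pow_succ, pow_mul, IsRoot.def, eval_map_pow_three, ih.eq_zero, zero_pow three_ne_zero]

/-- A root of an irreducible `h ∈ 𝔽₃[u]` of degree `d` has no Frobenius period `0 < k < d`
(its minimal polynomial `h` would divide `X^{3^k} − X`, forcing `d ∣ k`). [folklore] -/
theorem pow_three_pow_ne_self {h : (ZMod 3)[X]} (hirr : Irreducible h) (hmo : h.Monic) {x : E}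
    (hx : (h.map (algebraMap (ZMod 3) E)).IsRoot x) {k : ℕ} (hk0 : 0 < k) (hkd : k < h.natDegree) :
    x ^ 3 ^ k ≠ x := by
  intro hxk
  have hmin : h = minpoly (ZMod 3) x :=
    minpoly.eq_of_irreducible_of_monic hirr (by rwa [aeval_def, eval₂_eq_eval_map]) hmo
  have hcard : Nat.card (ZMod 3) = 3 := by simp [Nat.card_eq_fintype_card, ZMod.card]
  have hdvd : h ∣ X ^ Nat.card (ZMod 3) ^ k - X := by
    rw [hmin, hcard]
    apply minpoly.dvd
    simp [hxk]
  have := Nat.le_of_dvd hk0 (hirr.natDegree_dvd_of_dvd_X_pow_card_pow_sub_X hdvd)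
  omega

/-- The conjugates `x^{3^i}`, `i < deg h`, of a root `x` of an irreducible `h ∈ 𝔽₃[u]` are
pairwise distinct. [folklore] -/
theorem pow_three_pow_injOn {h : (ZMod 3)[X]} (hirr : Irreducible h) (hmo : h.Monic) {x : E}
    (hx : (h.map (algebraMap (ZMod 3) E)).IsRoot x) {i j : ℕ} (hi : i < h.natDegree)
    (hj : j < h.natDegree)
    (hij : x ^ 3 ^ i = x ^ 3 ^ j) : i = j := by
  have key : ∀ i j, i < j → j < h.natDegree → x ^ 3 ^ i ≠ x ^ 3 ^ j := by
    intro i j hij hjd heq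
    apply pow_three_pow_ne_self hirr hmo (isRoot_pow_three_pow hx i) (Nat.sub_pos_of_lt hij)
      (by omega : j - i < h.natDegree)
    rw [← pow_mul, ← pow_add, Nat.add_sub_cancel' hij.le]
    exact heq.symm
  rcases lt_trichotomy i j with h | h | h
  · exact absurd hij (key i j h hj)
  · exact h
  · exact absurd hij.symm (key j i h hi)

/-- The roots of a monic irreducible `h ∈ 𝔽₃[u]` in `\overline{𝔽₃}` are exactly the conjugates
`x^{3^i}`, `i < deg h`, of any one root `x`, each with multiplicity one. [folklore] -/
theorem roots_map_eq {h : (ZMod 3)[X]} (hirr : Irreducible h) (hmo : h.Monic) {x : E}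
    (hx : (h.map (algebraMap (ZMod 3) E)).IsRoot x) :
    (h.map (algebraMap (ZMod 3) E)).roots =
      (Finset.univ : Finset (Fin h.natDegree)).val.map
        fun i : Fin h.natDegree => x ^ 3 ^ i.val := by
  have hinj : Function.Injective fun i : Fin h.natDegree => x ^ 3 ^ i.val := fun i j hij =>
    Fin.ext (pow_three_pow_injOn hirr hmo hx i.isLt j.isLt hij)
  change _ = (Finset.univ.map ⟨fun i : Fin h.natDegree => x ^ 3 ^ i.val, hinj⟩).val
  apply roots_eq_of_natDegree_le_card_of_ne_zero
  · intro y hy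
    obtain ⟨i, -, rfl⟩ := Finset.mem_map.mp hy
    exact (isRoot_pow_three_pow hx i).eq_zero
  · simp [natDegree_map]
  · exact (hmo.map _).ne_zero

/-- `x^{3^d} = x` for a root `x` of a monic irreducible `h ∈ 𝔽₃[u]` of degree `d`. [folklore] -/
theorem pow_three_pow_natDegree {h : (ZMod 3)[X]} (hirr : Irreducible h) (hmo : h.Monic) {x : E}
    (hx : (h.map (algebraMap (ZMod 3) E)).IsRoot x) : x ^ 3 ^ h.natDegree = x := by
  have hmem : x ^ 3 ^ h.natDegree ∈ (h.map (algebraMap (ZMod 3) E)).roots :=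
    (mem_roots (hmo.map _).ne_zero).mpr (isRoot_pow_three_pow hx _)
  rw [roots_map_eq hirr hmo hx, Multiset.mem_map] at hmem
  obtain ⟨i, -, heq⟩ := hmem
  rcases Nat.eq_zero_or_pos (i : ℕ) with hi0 | hi0
  · rw [hi0] at heq; simpa using heq.symm
  · exfalso
    apply pow_three_pow_ne_self hirr hmo (isRoot_pow_three_pow hx i) (Nat.sub_pos_of_lt i.isLt)
      (Nat.sub_lt (by omega) hi0)
    rw [← pow_mul, ← pow_add, Nat.add_sub_cancel' i.isLt.le]
    exact heq.symm

/-- The value of the cyclic shift `finRotate d` on `Fin d`, for every `d`. [folklore] -/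
theorem finRotate_val (d : ℕ) (i : Fin d) :
    ((finRotate d i : Fin d) : ℕ) = if (i : ℕ) = d - 1 then 0 else (i : ℕ) + 1 := by
  cases d with
  | zero => exact i.elim0
  | succ k =>
    rw [coe_finRotate]
    simp [Fin.ext_iff]

/-- The product of `h'` over the roots of a monic irreducible `h ∈ 𝔽₃[u]` of degree `≡ 1 (mod 4)`
is `1` (Stickelberger–Swan parity, special case: the sign of Frobenius as a permutation of the
roots is `+1`, so `δ = ∏_{i<j} (γᵢ − γⱼ) ∈ 𝔽₃ˣ` and `∏ᵢ h'(γᵢ) = (−1)^{d(d−1)/2} δ² = 1`).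
[cite: ConradConradGross2008, Theorem 2.3 and (2.5)] -/
theorem prod_roots_eval_derivative [IsAlgClosed E] [CharP E 3] {h : (ZMod 3)[X]}
    (hirr : Irreducible h) (hmo : h.Monic) (hd : h.natDegree % 4 = 1) :
    ((h.map (algebraMap (ZMod 3) E)).roots.map
      fun y => eval y (derivative (h.map (algebraMap (ZMod 3) E)))).prod = 1 := by
  classical
  obtain ⟨x, hx⟩ : ∃ x, (h.map (algebraMap (ZMod 3) E)).IsRoot x :=
    IsAlgClosed.exists_root _ (by
      rw [degree_map, degree_eq_natDegree hirr.ne_zero]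
      exact_mod_cast (show h.natDegree ≠ 0 by omega))
  set d := h.natDegree with hd_def
  set v : Fin d → E := fun i : Fin d => x ^ 3 ^ i.val with hv
  have hinj : Function.Injective v := fun i j hij =>
    Fin.ext (pow_three_pow_injOn hirr hmo hx i.isLt j.isLt hij)
  have hroots : (h.map (algebraMap (ZMod 3) E)).roots = Finset.univ.val.map v :=
    roots_map_eq hirr hmo hx
  have hsplit : (h.map (algebraMap (ZMod 3) E)).Splits := IsAlgClosed.splits _
  -- Step 1: the product is `∏ i, ∏ j ≠ i, (v i - v j)`.
  have h1 : ((h.map (algebraMap (ZMod 3) E)).roots.map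
      fun y => eval y (derivative (h.map (algebraMap (ZMod 3) E)))).prod =
      ∏ i, ∏ j ∈ ({i}ᶜ : Finset (Fin d)), (v i - v j) := by
    rw [hroots, Multiset.map_map, Finset.prod_map_val]
    refine Finset.prod_congr rfl fun i _ => ?_
    rw [Function.comp_apply, hsplit.eval_root_derivative (hmo.map _)
      (by rw [hroots]; exact Multiset.mem_map_of_mem _ (Finset.mem_val.mpr (Finset.mem_univ _))),
      hroots, ← Multiset.map_erase v hinj, ← Finset.erase_val, Multiset.map_map,
      Finset.prod_map_val, Finset.compl_eq_univ_sdiff, Finset.sdiff_singleton_eq_erase]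
    rfl
  -- Step 2: `∏ i, ∏ j ≠ i, (v i - v j) = (-1)^N * det(V)^2`.
  have h2 : ∏ i, ∏ j ∈ ({i}ᶜ : Finset (Fin d)), (v i - v j) =
      (∏ i : Fin d, ∏ _j ∈ Finset.Ioi i, (-1 : E)) * (Matrix.vandermonde v).det ^ 2 := by
    rw [← Finset.prod_prod_Ioi_mul_eq_prod_prod_off_diag (fun a b => v b - v a),
      Matrix.det_vandermonde, ← Finset.prod_pow, ← Finset.prod_mul_distrib]
    refine Finset.prod_congr rfl fun i _ => ?_
    rw [← Finset.prod_pow, ← Finset.prod_mul_distrib]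
    refine Finset.prod_congr rfl fun j _ => ?_
    ring
  -- Step 3: the sign is `+1`.
  have h3 : (∏ i : Fin d, ∏ _j ∈ Finset.Ioi i, (-1 : E)) = 1 := by
    simp_rw [Finset.prod_const, Finset.prod_pow_eq_pow_sum, Fin.card_Ioi]
    have hsum : (∑ i : Fin d, (d - 1 - (i : ℕ))) * 2 = d * (d - 1) := by
      rw [Fin.sum_univ_eq_sum_range (fun i => d - 1 - i) d, Finset.sum_range_reflect (fun i => i) d,
        Finset.sum_range_id_mul_two]
    have h4 : 4 ∣ d * (d - 1) := Dvd.dvd.mul_left (Nat.dvd_of_mod_eq_zero (by omega)) d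
    rw [← hsum] at h4
    have heven : Even (∑ i : Fin d, (d - 1 - (i : ℕ))) := by
      obtain ⟨t, ht⟩ := h4
      exact ⟨t, by omega⟩
    exact heven.neg_one_pow
  -- Step 4: `det V` is fixed by Frobenius, hence `det(V)^2 = 1`.
  set V := Matrix.vandermonde v with hV
  have hVne : V.det ≠ 0 := Matrix.det_vandermonde_ne_zero_iff.mpr hinj
  have hperiod : x ^ 3 ^ d = x := pow_three_pow_natDegree hirr hmo hx
  have hV3 : V.det ^ 3 = V.det := by
    have e1 : V.det ^ 3 = ((frobenius E 3).mapMatrix V).det := by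
      rw [← RingHom.map_det, frobenius_def]
    have e2 : (frobenius E 3).mapMatrix V = V.submatrix (finRotate d) id := by
      ext i j
      simp only [hV, RingHom.mapMatrix_apply, Matrix.map_apply, Matrix.vandermonde_apply,
        frobenius_def, Matrix.submatrix_apply, id]
      rw [← pow_mul, mul_comm, pow_mul]
      congr 1
      -- `v i ^ 3 = v (finRotate d i)`
      simp only [hv]
      rw [finRotate_val]
      split_ifs with hi
      · rw [← pow_mul, ← pow_succ, hi, Nat.sub_add_cancel (by omega), hperiod, pow_zero, pow_one]
      · rw [← pow_mul, ← pow_succ]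
    have e3 : (V.submatrix (finRotate d) id).det = V.det := by
      rw [Matrix.det_permute, sign_finRotate, Even.neg_one_pow ⟨(d - 1) / 2, by omega⟩]
      simp
    rw [e1, e2, e3]
  have hV2 : V.det ^ 2 = 1 := by
    have : V.det * (V.det ^ 2 - 1) = 0 := by linear_combination hV3
    rcases mul_eq_zero.mp this with h0 | h0
    · exact absurd h0 hVne
    · exact sub_eq_zero.mp h0
  rw [h1, h2, h3, hV2, one_mul]

/-- Monic case of the Stickelberger–Swan special case, as a resultant identity over `𝔽₃`:
`Res_{d,n}(h, h') = 1` for `h` monic irreducible of degree `d ≡ 1 (mod 4)`, `n ≥ deg h'`.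
[cite: ConradConradGross2008, Theorem 2.3 and (2.5)] -/
theorem resultant_derivative_of_monic {h : (ZMod 3)[X]} (hirr : Irreducible h) (hmo : h.Monic)
    (hd : h.natDegree % 4 = 1) {n : ℕ} (hn : (derivative h).natDegree ≤ n) :
    resultant h (derivative h) h.natDegree n = 1 := by
  apply (algebraMap (ZMod 3) (AlgebraicClosure (ZMod 3))).injective
  rw [← resultant_map_map, map_one, show h.natDegree =
      (h.map (algebraMap (ZMod 3) (AlgebraicClosure (ZMod 3)))).natDegree from
        (natDegree_map _).symm,
    resultant_eq_prod_eval _ _ n (by rwa [natDegree_map]) (IsAlgClosed.splits _),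
    (hmo.map _).leadingCoeff, one_pow, one_mul, ← derivative_map]
  exact prod_roots_eval_derivative hirr hmo hd

/-- **Stickelberger–Swan parity, special case.** For `h ∈ 𝔽₃[u]` irreducible of degree
`d ≡ 1 (mod 4)` and any `n ≥ deg h'`, `Res_{d,n}(h, h') = lead(h)^{d+n}` (equivalently, by
(2.4), `disc h` is a non-zero square in `𝔽₃`, i.e. `μ(h) = (−1)^{deg h} χ(disc h) = −1` as (2.5)
demands for a prime `h` of odd degree). [cite: ConradConradGross2008, Theorem 2.3 and (2.5)] -/
theorem resultant_derivative_of_irreducible {h : (ZMod 3)[X]} (hirr : Irreducible h)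
    (hd : h.natDegree % 4 = 1) {n : ℕ} (hn : (derivative h).natDegree ≤ n) :
    resultant h (derivative h) h.natDegree n = h.leadingCoeff ^ (h.natDegree + n) := by
  set c := h.leadingCoeff with hc_def
  have hc : c ≠ 0 := leadingCoeff_ne_zero.mpr hirr.ne_zero
  set h₁ := h * C c⁻¹ with h₁_def
  have hmo : h₁.Monic := monic_mul_leadingCoeff_inv hirr.ne_zero
  have hirr₁ : Irreducible h₁ := (irreducible_mul_leadingCoeff_inv).mpr hirr
  have hh : h = C c * h₁ := by
    rw [h₁_def, mul_left_comm, ← C_mul, mul_inv_cancel₀ hc, C_1, mul_one]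
  have hd₁ : h₁.natDegree = h.natDegree := by
    rw [h₁_def, natDegree_mul_C (inv_ne_zero hc)]
  have hder : derivative h = C c * derivative h₁ := by
    conv_lhs => rw [hh]
    rw [derivative_C_mul]
  have hn₁ : (derivative h₁).natDegree ≤ n := by
    have : derivative h₁ = C c⁻¹ * derivative h := by
      rw [hder, ← mul_assoc, ← C_mul, inv_mul_cancel₀ hc, C_1, one_mul]
    rw [this]
    exact (natDegree_C_mul_le _ _).trans hn
  have e1 : resultant h (derivative h) h.natDegree n =
      resultant (C c * h₁) (C c * derivative h₁) h.natDegree n := by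
    congr 1
  rw [e1, resultant_C_mul_left, resultant_C_mul_right, ← hd₁,
    resultant_derivative_of_monic hirr₁ hmo (hd₁ ▸ hd) hn₁, mul_one, ← pow_add, add_comm]

end Stickelberger

/-! ### Step 2: the resultant formula (CCG Example 3.3, (3.8)) for `f = ccgPoly` -/

/-! Throughout, `D` stands for `(u + 1) g⁶ + 2 g³ + 2u + 2 = (f(g))′` (hypothesis `hD`;
`derivative_ccgPoly_eval`), and `g² + g + 2` is `g` composed with the irreducible quadratic
`T² + T + 2 ∈ 𝔽₃[T]`. -/

variable {g D : (ZMod 3)[X]}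

/-- `c² = 1` for the leading coefficient `c ∈ 𝔽₃ˣ` of a non-zero `g ∈ 𝔽₃[u]`. [folklore] -/
theorem lc_sq (hg : g ≠ 0) : g.leadingCoeff ^ 2 = 1 := by
  have := ZMod.pow_card_sub_one_eq_one (leadingCoeff_ne_zero.mpr hg)
  simpa using this

/-- `deg D = 6 deg g + 1` and `lead D = c⁶` (`deg g ≥ 1`).
[cite: ConradConradGross2008, Example 3.1] -/
theorem natDegree_D (hD : D = (X + 1) * g ^ 6 + 2 * g ^ 3 + (2 * X + 2))
    (hm : 1 ≤ g.natDegree) :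
    D.natDegree = 6 * g.natDegree + 1 ∧ D.leadingCoeff = g.leadingCoeff ^ 6 := by
  subst hD
  have hg : g ≠ 0 := ne_zero_of_natDegree_gt hm
  have hX1 : (X + 1 : (ZMod 3)[X]) = X + C 1 := by rw [C_1]
  have h1 : ((X + 1) * g ^ 6 : (ZMod 3)[X]).natDegree = 6 * g.natDegree + 1 := by
    rw [natDegree_mul (by rw [hX1]; exact X_add_C_ne_zero 1) (pow_ne_zero _ hg), hX1,
      natDegree_X_add_C, natDegree_pow]
    ring
  have h2 : (2 * g ^ 3 + (2 * X + 2) : (ZMod 3)[X]).natDegree < 6 * g.natDegree + 1 := by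
    have : (2 * g ^ 3 + (2 * X + 2) : (ZMod 3)[X]).natDegree ≤ 3 * g.natDegree + 1 := by
      compute_degree!
    omega
  constructor
  · rw [add_assoc, natDegree_add_eq_left_of_natDegree_lt (by rwa [h1]), h1]
  · rw [add_assoc, leadingCoeff_add_of_degree_lt' (degree_lt_degree (by rwa [h1])),
      leadingCoeff_mul, leadingCoeff_pow, hX1, leadingCoeff_X_add_C, one_mul]

/-- `f(g) = g⁹ + (terms of degree ≤ 6 deg g + 2)`. [cite: ConradConradGross2008, Example 1.2] -/
theorem ccgPoly_eval_eq_pow_add (g : (ZMod 3)[X]) : ccgPoly.eval g =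
    g ^ 9 + ((2 * X ^ 2 + X) * g ^ 6 + (2 * X + 2) * g ^ 3 + (X ^ 2 + 2 * X + 1)) := by
  rw [ccgPoly_eval]; ring

/-- `deg f(g) = 9 deg g` and `lead f(g) = c⁹` (`deg g ≥ 1`).
[cite: ConradConradGross2008, Example 3.1] -/
theorem natDegree_ccgPoly_eval (hm : 1 ≤ g.natDegree) :
    (ccgPoly.eval g).natDegree = 9 * g.natDegree ∧
      (ccgPoly.eval g).leadingCoeff = g.leadingCoeff ^ 9 := by
  rw [ccgPoly_eval_eq_pow_add]
  have h1 : (g ^ 9).natDegree = 9 * g.natDegree := natDegree_pow _ _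
  have h2 : ((2 * X ^ 2 + X) * g ^ 6 + (2 * X + 2) * g ^ 3 + (X ^ 2 + 2 * X + 1) :
      (ZMod 3)[X]).natDegree < 9 * g.natDegree := by
    have : ((2 * X ^ 2 + X) * g ^ 6 + (2 * X + 2) * g ^ 3 + (X ^ 2 + 2 * X + 1) :
        (ZMod 3)[X]).natDegree ≤ 6 * g.natDegree + 2 := by
      compute_degree!
      omega
    omega
  constructor
  · rw [natDegree_add_eq_left_of_natDegree_lt (by rwa [h1]), h1]
  · rw [leadingCoeff_add_of_degree_lt' (degree_lt_degree (by rwa [h1])), leadingCoeff_pow]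

/-- `deg (g² + g + 2) = 2 deg g`, with leading coefficient `c² = 1` (`deg g ≥ 1`). [folklore] -/
theorem natDegree_Q (hm : 1 ≤ g.natDegree) :
    ((g ^ 2 + g + 2)).natDegree = 2 * g.natDegree ∧ ((g ^ 2 + g + 2)).leadingCoeff = 1 := by
  have hg : g ≠ 0 := ne_zero_of_natDegree_gt hm
  have h1 : (g ^ 2).natDegree = 2 * g.natDegree := natDegree_pow _ _
  have h2 : (g + 2 : (ZMod 3)[X]).natDegree < 2 * g.natDegree := by
    have : (g + 2 : (ZMod 3)[X]).natDegree ≤ g.natDegree := by compute_degree!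
    omega
  constructor
  · rw [add_assoc, natDegree_add_eq_left_of_natDegree_lt (by rwa [h1]), h1]
  · rw [add_assoc, leadingCoeff_add_of_degree_lt' (degree_lt_degree (by rwa [h1])),
      leadingCoeff_pow, lc_sq hg]

/-- `deg (g² − 1) = 2 deg g`, with leading coefficient `c² = 1` (`deg g ≥ 1`). [folklore] -/
theorem natDegree_gsq (hm : 1 ≤ g.natDegree) :
    (g ^ 2 - 1 : (ZMod 3)[X]).natDegree = 2 * g.natDegree ∧
      (g ^ 2 - 1 : (ZMod 3)[X]).leadingCoeff = 1 := by
  have hg : g ≠ 0 := ne_zero_of_natDegree_gt hm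
  have h1 : (g ^ 2).natDegree = 2 * g.natDegree := natDegree_pow _ _
  have h2 : (1 : (ZMod 3)[X]).natDegree < (g ^ 2).natDegree := by rw [h1, natDegree_one]; omega
  constructor
  · rw [natDegree_sub_eq_left_of_natDegree_lt h2, h1]
  · rw [sub_eq_add_neg,
      leadingCoeff_add_of_degree_lt' (by rw [degree_neg]; exact degree_lt_degree h2),
      leadingCoeff_pow, lc_sq hg]

/-- `deg (g + a) = deg g` and `lead (g + a) = lead g` for a constant `a` (`deg g ≥ 1`).
[folklore] -/
theorem natDegree_g_add_C (hm : 1 ≤ g.natDegree) (a : ZMod 3) :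
    (g + C a).natDegree = g.natDegree ∧ (g + C a).leadingCoeff = g.leadingCoeff := by
  refine ⟨natDegree_add_C, leadingCoeff_add_of_degree_lt' ?_⟩
  exact degree_C_le.trans_lt (natDegree_pos_iff_degree_pos.mp hm)

/-! ### The four polynomial identities (characteristic 3) -/

/-- The key identity `(g² − 1)³ · f(g) = g⁹ (g² + g + 2)³ − D²` in `𝔽₃[u]`: writing
`f(g) = −A u² + B u + C` with `A = (g²−1)³`, `B = (g²−g−1)³`, `C = (g³−g+1)³ ∈ 𝔽₃[u³]`, one has
`D = A u + B` and `A·C + B² = (g³(g²+g+2))³`; this is the discriminant of `f` as a quadratic in `u`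
(cf. the resultant `R(f(g), (∂ᵤ f)(g))` of (3.8)). [cite: ConradConradGross2008, Example 3.3] -/
theorem gsq_cube_mul_ccgPoly_eval (hD : D = (X + 1) * g ^ 6 + 2 * g ^ 3 + (2 * X + 2)) :
    (g ^ 2 - 1) ^ 3 * ccgPoly.eval g = g ^ 9 * (g ^ 2 + g + 2) ^ 3 + D * (-D) := by
  subst hD
  rw [ccgPoly_eval]
  ring_nf
  reduce_mod_char
  ring_nf
  reduce_mod_char

/-- `D ≡ −g (mod g² − 1)`, with an explicit quotient (characteristic `3`).
[cite: ConradConradGross2008, Example 3.3 (3.8)] -/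
theorem D_mod_gsq (hD : D = (X + 1) * g ^ 6 + 2 * g ^ 3 + (2 * X + 2)) :
    D = -g + (g ^ 2 - 1) * ((X + 1) * (g ^ 4 + g ^ 2 + 1) + 2 * g) := by
  subst hD
  ring_nf
  reduce_mod_char
  ring

/-- `D ≡ 2u + 2 (mod g)`, with an explicit quotient.
[cite: ConradConradGross2008, Example 3.3 (3.8)] -/
theorem D_mod_g (hD : D = (X + 1) * g ^ 6 + 2 * g ^ 3 + (2 * X + 2)) :
    D = (C 2 * X + C 2) + g * ((X + 1) * g ^ 5 + 2 * g ^ 2) := by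
  subst hD
  simp only [map_ofNat]
  ring

/-- `D ≡ (u + 2)(g + 1) (mod g² + g + 2)`, with an explicit quotient (characteristic `3`).
[cite: ConradConradGross2008, Example 3.3 (3.8)] -/
theorem D_mod_Q (hD : D = (X + 1) * g ^ 6 + 2 * g ^ 3 + (2 * X + 2)) :
    D = (X + C 2) * (g + C 1) +
      (g ^ 2 + g + 2) * ((X + 1) * (g ^ 4 + 2 * g ^ 3 + 2 * g ^ 2 + 2) + 2 * g + 1) := by
  subst hD
  simp only [map_ofNat, map_one]
  ring_nf
  reduce_mod_char

/-- `(f(g))′ = (∂ᵤ f)(g) = (u + 1) g⁶ + 2 g³ + 2u + 2` in characteristic `3` (`f ∈ κ[u][T³]`).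
[cite: ConradConradGross2008, Example 3.1] -/
theorem derivative_ccgPoly_eval (g : (ZMod 3)[X]) :
    derivative (ccgPoly.eval g) = (X + 1) * g ^ 6 + 2 * g ^ 3 + (2 * X + 2) := by
  rw [ccgPoly_eval]
  simp only [derivative_add, derivative_mul, derivative_pow, derivative_X,
    derivative_ofNat, derivative_one, map_natCast]
  ring_nf
  reduce_mod_char

/-! ### Values of `f(g)` at `u = 1, 2` -/

/-- `f(g)|_{u=1} = (g(1) − 1)³ (g(1)² + g(1) + 2)³ = 2 g(1) + 1` in `𝔽₃` (first half of (6.5)).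
[cite: ConradConradGross2008, Example 6.10 (6.5)] -/
theorem ccgPoly_eval_eval_one (g : (ZMod 3)[X]) : (ccgPoly.eval g).eval 1 = 2 * g.eval 1 + 1 := by
  rw [ccgPoly_eval]
  simp only [eval_add, eval_mul, eval_pow, eval_X, eval_ofNat, eval_one]
  generalize g.eval 1 = a
  revert a; decide

/-- `f(g)|_{u=2} = g(2)⁶ (g(2) + 1)³ = g(2) + g(2)²` in `𝔽₃` (second half of (6.5)).
[cite: ConradConradGross2008, Example 6.10 (6.5)] -/
theorem ccgPoly_eval_eval_two (g : (ZMod 3)[X]) :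
    (ccgPoly.eval g).eval 2 = g.eval 2 + (g.eval 2) ^ 2 := by
  rw [ccgPoly_eval]
  simp only [eval_add, eval_mul, eval_pow, eval_X, eval_ofNat, eval_one]
  generalize g.eval 2 = a
  revert a; decide

/-! ### The three resultant chains -/

/-- `Res(D, g² − 1) = −1`: swap, reduce `D ≡ −g (mod g² − 1)`, swap, reduce `g² − 1 ≡ −1 (mod g)`
(the factor `(g² − 1)³ = (g − 1)³(g + 1)³` of `R(f(g), (∂ᵤf)(g))` meets no intersection point).
[cite: ConradConradGross2008, Example 3.3 (3.8)] -/
theorem res_D_gsq (hD : D = (X + 1) * g ^ 6 + 2 * g ^ 3 + (2 * X + 2))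
    (hm4 : g.natDegree % 4 = 1) :
    resultant D (g ^ 2 - 1) (6 * g.natDegree + 1) (2 * g.natDegree) = -1 := by
  have hm : 1 ≤ g.natDegree := by omega
  have hg : g ≠ 0 := ne_zero_of_natDegree_gt hm
  obtain ⟨hd2, hl2⟩ := natDegree_gsq hm
  have hcoeff : (g ^ 2 - 1 : (ZMod 3)[X]).coeff (2 * g.natDegree) = 1 := by
    rw [← hd2, coeff_natDegree, hl2]
  have hP : ((X + 1) * (g ^ 4 + g ^ 2 + 1) + 2 * g : (ZMod 3)[X]).natDegree + 2 * g.natDegree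
      ≤ 6 * g.natDegree + 1 := by
    have : ((X + 1) * (g ^ 4 + g ^ 2 + 1) + 2 * g : (ZMod 3)[X]).natDegree ≤
        4 * g.natDegree + 1 := by
      compute_degree!
      omega
    omega
  have s1 : resultant D (g ^ 2 - 1) (6 * g.natDegree + 1) (2 * g.natDegree) =
      resultant (g ^ 2 - 1) D (2 * g.natDegree) (6 * g.natDegree + 1) := by
    rw [resultant_comm, Even.neg_one_pow ⟨(6 * g.natDegree + 1) * g.natDegree, by ring⟩, one_mul]
  have s2 : resultant (g ^ 2 - 1) D (2 * g.natDegree) (6 * g.natDegree + 1) =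
      resultant (g ^ 2 - 1) (-g) (2 * g.natDegree) (6 * g.natDegree + 1) := by
    conv_lhs => rw [D_mod_gsq hD]
    exact resultant_add_mul_right _ _ _ _ _ hP hd2.le
  have s3 : resultant (g ^ 2 - 1) (-g) (2 * g.natDegree) (6 * g.natDegree + 1) =
      resultant (g ^ 2 - 1) (-g) (2 * g.natDegree) g.natDegree := by
    rw [show 6 * g.natDegree + 1 = g.natDegree + (5 * g.natDegree + 1) by ring,
      resultant_add_right_deg _ _ _ _ _ (by rw [natDegree_neg]), hcoeff, one_pow, one_mul]
  have s4 : resultant (g ^ 2 - 1) (-g) (2 * g.natDegree) g.natDegree =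
      resultant g (g ^ 2 - 1) g.natDegree (2 * g.natDegree) := by
    rw [show (-g) = C (-1) * g by simp, resultant_C_mul_right,
      Even.neg_one_pow ⟨g.natDegree, by ring⟩, one_mul, resultant_comm,
      Even.neg_one_pow ⟨g.natDegree * g.natDegree, by ring⟩, one_mul]
  have s5 : resultant g (g ^ 2 - 1) g.natDegree (2 * g.natDegree) = -1 := by
    rw [show (g ^ 2 - 1 : (ZMod 3)[X]) = C (-1) + g * g by rw [map_neg, map_one]; ring,
      resultant_add_mul_right _ _ _ _ _ (by omega) le_rfl, resultant_C_right, coeff_natDegree,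
      pow_mul, lc_sq hg, one_pow, one_mul]
    exact Odd.neg_one_pow (Nat.odd_iff.mpr (by omega))
  rw [s1, s2, s3, s4, s5]

/-- `Res(D, g) = −g(2)`: swap and reduce `D ≡ 2(u + 1) (mod g)` (the intersection point
`(u, T) = (2, 0)` of `Z_f ∩ Z_{∂ᵤf}`, contributing `g(2)⁹` to (3.8)).
[cite: ConradConradGross2008, Example 3.3 (3.8)] -/
theorem res_D_g (hD : D = (X + 1) * g ^ 6 + 2 * g ^ 3 + (2 * X + 2))
    (hm4 : g.natDegree % 4 = 1) :
    resultant D g (6 * g.natDegree + 1) g.natDegree = -g.eval 2 := by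
  have hm : 1 ≤ g.natDegree := by omega
  have hg : g ≠ 0 := ne_zero_of_natDegree_gt hm
  have hP : ((X + 1) * g ^ 5 + 2 * g ^ 2 : (ZMod 3)[X]).natDegree + g.natDegree
      ≤ 6 * g.natDegree + 1 := by
    have : ((X + 1) * g ^ 5 + 2 * g ^ 2 : (ZMod 3)[X]).natDegree ≤ 5 * g.natDegree + 1 := by
      compute_degree!
      omega
    omega
  have s1 : resultant D g (6 * g.natDegree + 1) g.natDegree =
      -resultant g D g.natDegree (6 * g.natDegree + 1) := by
    rw [resultant_comm, (Nat.odd_mul.mpr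
      ⟨Nat.odd_iff.mpr (by omega), Nat.odd_iff.mpr (by omega)⟩).neg_one_pow, neg_one_mul]
  have s2 : resultant g D g.natDegree (6 * g.natDegree + 1) =
      resultant g (C 2 * X + C 2) g.natDegree (6 * g.natDegree + 1) := by
    conv_lhs => rw [D_mod_g hD]
    exact resultant_add_mul_right _ _ _ _ _ hP le_rfl
  have s3 : resultant g (C 2 * X + C 2) g.natDegree (6 * g.natDegree + 1) =
      resultant g (C 2 * X + C 2) g.natDegree 1 := by
    rw [show 6 * g.natDegree + 1 = 1 + 6 * g.natDegree by ring,
      resultant_add_right_deg _ _ _ _ _ (by compute_degree!), coeff_natDegree,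
      show 6 * g.natDegree = 2 * (3 * g.natDegree) by ring, pow_mul, lc_sq hg, one_pow, one_mul]
  have s4 : resultant g (C 2 * X + C 2) g.natDegree 1 = g.eval 2 := by
    rw [show (C 2 * X + C 2 : (ZMod 3)[X]) = C 2 * (X + C 1) by rw [map_one]; ring,
      resultant_C_mul_right,
      resultant_X_add_C_right _ _ _ le_rfl, ← mul_assoc, ← mul_pow,
      show (2 * -1 : ZMod 3) = 1 by decide, one_pow, one_mul, show (-1 : ZMod 3) = 2 by decide]
  rw [s1, s2, s3, s4]

/-- `2^m = 2` in `𝔽₃` for odd `m`. [folklore] -/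
theorem two_pow_odd {m : ℕ} (hm : m % 2 = 1) : (2 : ZMod 3) ^ m = 2 := by
  obtain ⟨k, hk⟩ : ∃ k, m = 2 * k + 1 := ⟨m / 2, by omega⟩
  rw [hk, pow_succ, pow_mul, show (2 : ZMod 3) ^ 2 = 1 by decide, one_pow, one_mul]

/-- `Res(D, g² + g + 2) = −(g(1)² + g(1) + 2)`: swap and reduce `D ≡ (u + 2)(g + 1)
(mod g² + g + 2)` (the intersection points `(1, t)`, `t² + t + 2 = 0`, contributing
`(g(1)² + g(1) + 2)³` to (3.8)).
[cite: ConradConradGross2008, Example 3.3 (3.8)] -/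
theorem res_D_Q (hD : D = (X + 1) * g ^ 6 + 2 * g ^ 3 + (2 * X + 2))
    (hm4 : g.natDegree % 4 = 1) :
    resultant D (g ^ 2 + g + 2) (6 * g.natDegree + 1) (2 * g.natDegree) =
      -((g.eval 1) ^ 2 + g.eval 1 + 2) := by
  have hm : 1 ≤ g.natDegree := by omega
  have hg : g ≠ 0 := ne_zero_of_natDegree_gt hm
  obtain ⟨hdQ, hlQ⟩ := natDegree_Q hm
  obtain ⟨hd1, hl1⟩ := natDegree_g_add_C hm 1
  have hcoeff : ((g ^ 2 + g + 2)).coeff (2 * g.natDegree) = 1 := by rw [← hdQ, coeff_natDegree, hlQ]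
  have hcoeff1 : (g + C 1).coeff g.natDegree = g.leadingCoeff := by
    rw [← hl1, ← coeff_natDegree, hd1]
  have hP : ((X + 1) * (g ^ 4 + 2 * g ^ 3 + 2 * g ^ 2 + 2) + 2 * g + 1 : (ZMod 3)[X]).natDegree
      + 2 * g.natDegree ≤ 6 * g.natDegree + 1 := by
    have : ((X + 1) * (g ^ 4 + 2 * g ^ 3 + 2 * g ^ 2 + 2) + 2 * g + 1 : (ZMod 3)[X]).natDegree
        ≤ 4 * g.natDegree + 1 := by
      compute_degree!
      omega
    omega
  have hdeg : ((X + C 2) * (g + C 1) : (ZMod 3)[X]).natDegree ≤ 1 + g.natDegree := by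
    compute_degree!
  have s1 : resultant D (g ^ 2 + g + 2) (6 * g.natDegree + 1) (2 * g.natDegree) =
      resultant (g ^ 2 + g + 2) D (2 * g.natDegree) (6 * g.natDegree + 1) := by
    rw [resultant_comm, Even.neg_one_pow ⟨(6 * g.natDegree + 1) * g.natDegree, by ring⟩, one_mul]
  have s2 : resultant (g ^ 2 + g + 2) D (2 * g.natDegree) (6 * g.natDegree + 1) =
      resultant (g ^ 2 + g + 2) ((X + C 2) * (g + C 1)) (2 * g.natDegree)
        (6 * g.natDegree + 1) := by
    conv_lhs => rw [D_mod_Q hD]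
    exact resultant_add_mul_right _ _ _ _ _ hP hdQ.le
  have s3 :
      resultant (g ^ 2 + g + 2) ((X + C 2) * (g + C 1)) (2 * g.natDegree) (6 * g.natDegree + 1) =
      resultant (g ^ 2 + g + 2) ((X + C 2) * (g + C 1)) (2 * g.natDegree)
        ((X + C 2 : (ZMod 3)[X]).natDegree + (g + C 1).natDegree) := by
    rw [natDegree_X_add_C, hd1,
      show 6 * g.natDegree + 1 = (1 + g.natDegree) + 5 * g.natDegree by ring,
      resultant_add_right_deg _ _ _ _ _ hdeg, hcoeff, one_pow, one_mul]
  have s4 : resultant (g ^ 2 + g + 2) ((X + C 2) * (g + C 1)) (2 * g.natDegree)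
        ((X + C 2 : (ZMod 3)[X]).natDegree + (g + C 1).natDegree) =
      resultant (g ^ 2 + g + 2) (X + C 2) (2 * g.natDegree) 1 *
        resultant (g ^ 2 + g + 2) (g + C 1) (2 * g.natDegree) g.natDegree := by
    rw [resultant_mul_right _ _ _ _ hdQ.le, natDegree_X_add_C, hd1]
  have s5 : resultant (g ^ 2 + g + 2) (X + C 2) (2 * g.natDegree) 1 =
      (g.eval 1) ^ 2 + g.eval 1 + 2 := by
    rw [resultant_X_add_C_right _ _ _ hdQ.le, Even.neg_one_pow ⟨g.natDegree, by ring⟩, one_mul,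
      show (-2 : ZMod 3) = 1 by decide]
    simp only [eval_add, eval_pow, eval_ofNat]
  have s6 : resultant (g ^ 2 + g + 2) (g + C 1) (2 * g.natDegree) g.natDegree = 2 := by
    rw [resultant_comm, Even.neg_one_pow ⟨g.natDegree * g.natDegree, by ring⟩, one_mul,
      show (g ^ 2 + g + 2) = C 2 + (g + C 1) * g by simp only [map_ofNat, map_one]; ring,
      resultant_add_mul_right _ _ _ _ _ (by omega) hd1.le, resultant_C_right, hcoeff1,
      pow_mul, lc_sq hg, one_pow, one_mul]
    exact two_pow_odd (by omega)
  rw [s1, s2, s3, s4, s5, s6, show (2 : ZMod 3) = -1 by decide, mul_neg_one]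

/-! ### Assembly: `Res(f(g), f(g)') = g(2) (g(1)² + g(1) + 2)` -/

/-- **The resultant formula (3.8), reduced in `𝔽₃`.** For `deg g = m ≡ 1 (mod 4)`,
`Res_{9m, 6m+1}(f(g), f(g)′) = g(2) · (g(1)² + g(1) + 2)`; this is CCG's
`R(f(g), (∂ᵤf)(g)) = c^{54n−6} (g(1)² + g(1) + 2)³ g(2)⁹` with `c² = 1` and `x³ = x` in `𝔽₃`.
Proof: `Res(f(g), D) = −Res(D, f(g))`, `Res(D, (g²−1)³)·Res(D, f(g)) = Res(D, (g²−1)³ f(g)) =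
Res(D, g⁹(g²+g+2)³ − D²) = Res(D, g)⁹ Res(D, g²+g+2)³` and the three chains `res_D_gsq`,
`res_D_g`, `res_D_Q`. [cite: ConradConradGross2008, Example 3.3 (3.8)] -/
theorem resultant_ccgPoly_derivative (hD : D = (X + 1) * g ^ 6 + 2 * g ^ 3 + (2 * X + 2))
    (hm4 : g.natDegree % 4 = 1) :
    resultant (ccgPoly.eval g) D (9 * g.natDegree) (6 * g.natDegree + 1) =
      g.eval 2 * ((g.eval 1) ^ 2 + g.eval 1 + 2) := by
  have hm : 1 ≤ g.natDegree := by omega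
  have hg : g ≠ 0 := ne_zero_of_natDegree_gt hm
  obtain ⟨hdh, hlh⟩ := natDegree_ccgPoly_eval hm
  obtain ⟨hdD, hlD⟩ := natDegree_D hD hm
  obtain ⟨hdQ, hlQ⟩ := natDegree_Q hm
  obtain ⟨hd2, hl2⟩ := natDegree_gsq hm
  have s1 : resultant (ccgPoly.eval g) D (9 * g.natDegree) (6 * g.natDegree + 1) =
      -resultant D (ccgPoly.eval g) (6 * g.natDegree + 1) (9 * g.natDegree) := by
    rw [resultant_comm, (Nat.odd_mul.mpr
      ⟨Nat.odd_iff.mpr (by omega), Nat.odd_iff.mpr (by omega)⟩).neg_one_pow, neg_one_mul]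
  -- `Res(D, A h) = Res(D, A) Res(D, h)` with `A = (g² - 1)³`
  have s2 :=
    resultant_mul_right D ((g ^ 2 - 1) ^ 3) (ccgPoly.eval g) (6 * g.natDegree + 1) hdD.le
  have hA : resultant D ((g ^ 2 - 1) ^ 3) (6 * g.natDegree + 1)
      ((g ^ 2 - 1) ^ 3 : (ZMod 3)[X]).natDegree = -1 := by
    rw [resultant_pow_right _ _ _ _ hdD.le (by rw [hl2]; simp), hd2, res_D_gsq hD hm4]
    norm_num
  have hdA : ((g ^ 2 - 1) ^ 3 : (ZMod 3)[X]).natDegree = 6 * g.natDegree := by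
    rw [natDegree_pow, hd2]; ring
  rw [hA, hdA, hdh, show 6 * g.natDegree + 9 * g.natDegree = 15 * g.natDegree by ring] at s2
  -- `A h = W - D²`
  have s3 : resultant D ((g ^ 2 - 1) ^ 3 * ccgPoly.eval g) (6 * g.natDegree + 1)
      (15 * g.natDegree) =
      resultant D (g ^ 9 * (g ^ 2 + g + 2) ^ 3) (6 * g.natDegree + 1) (15 * g.natDegree) := by
    rw [gsq_cube_mul_ccgPoly_eval hD]
    exact resultant_add_mul_right _ _ _ _ _ (by rw [natDegree_neg, hdD]; omega) hdD.le
  -- `Res(D, g⁹ Q³) = Res(D, g)⁹ Res(D, Q)³`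
  have s4 : resultant D (g ^ 9 * (g ^ 2 + g + 2) ^ 3) (6 * g.natDegree + 1) (15 * g.natDegree) =
      (resultant D g (6 * g.natDegree + 1) g.natDegree) ^ 9 *
        (resultant D (g ^ 2 + g + 2) (6 * g.natDegree + 1) (2 * g.natDegree)) ^ 3 := by
    have e := resultant_mul_right D (g ^ 9) ((g ^ 2 + g + 2) ^ 3) (6 * g.natDegree + 1) hdD.le
    rw [resultant_pow_right _ _ _ _ hdD.le (by simp [hg]),
      resultant_pow_right _ _ _ _ hdD.le (by rw [hlQ]; simp)] at e
    rw [natDegree_pow, natDegree_pow, hdQ,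
      show 9 * g.natDegree + 3 * (2 * g.natDegree) = 15 * g.natDegree by ring] at e
    exact e
  have key : -1 * resultant D (ccgPoly.eval g) (6 * g.natDegree + 1) (9 * g.natDegree) =
      (-g.eval 2) ^ 9 * (-((g.eval 1) ^ 2 + g.eval 1 + 2)) ^ 3 := by
    rw [← s2, s3, s4, res_D_g hD hm4, res_D_Q hD hm4]
  rw [s1, ← neg_one_mul, key]
  generalize g.eval 1 = a
  generalize g.eval 2 = b
  revert a b; decide

end FunctionFieldMobiusBias

/-! ### Step 3: assembly (CCG Example 6.10) -/

open FunctionFieldMobiusBias in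
/-- **Möbius (parity) bias in the function-field Bateman–Horn problem holds** (Conrad–Conrad–Gross
2008, Example 6.10): for `f(T) = T⁹ + (2u² + u)T⁶ + (2u + 2)T³ + u² + 2u + 1 ∈ 𝔽₃[u][T]` and every
`g ∈ 𝔽₃[u]` with `deg g ≡ 1 (mod 4)`, `f(g)` is not irreducible in `𝔽₃[u]`. Discharges the named
fact `FunctionFieldMobiusBias` via the Stickelberger–Swan parity computation
(`resultant_derivative_of_irreducible`, CCG Theorem 2.3 / (2.5)) and the resultant formula (3.8)
(`resultant_ccgPoly_derivative`), closed by the values (6.5) of `f(g)` at `u = 1, 2`.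
[cite: ConradConradGross2008, Example 6.10] [cite: ConradConradGross2008, Example 3.3 (3.8)–(3.9)]
[cite: ConradConradGross2008, Theorem 2.3 and (2.5)] -/
theorem FunctionFieldMobiusBias_holds : FunctionFieldMobiusBias := by
  intro g hm4 hirr
  have hm : 1 ≤ g.natDegree := by omega
  have hg : g ≠ 0 := ne_zero_of_natDegree_gt hm
  obtain ⟨hdh, hlh⟩ := natDegree_ccgPoly_eval hm
  have hD := derivative_ccgPoly_eval g
  obtain ⟨hdD, -⟩ := natDegree_D hD hm
  -- Step 1: `Res(f(g), f(g)') = lead^{even} = 1`.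
  have hS := resultant_derivative_of_irreducible hirr (by rw [hdh]; omega)
    (n := 6 * g.natDegree + 1) hdD.le
  have hc1 : (g.leadingCoeff ^ 9) ^ (9 * g.natDegree + (6 * g.natDegree + 1)) = 1 := by
    obtain ⟨k, hk⟩ : ∃ k, 9 * g.natDegree + (6 * g.natDegree + 1) = 2 * k :=
      ⟨(15 * g.natDegree + 1) / 2, by omega⟩
    rw [hk, ← pow_mul, show 9 * (2 * k) = 2 * (9 * k) by ring, pow_mul, lc_sq hg, one_pow]
  -- Step 2: `Res(f(g), f(g)') = g(2) (g(1)² + g(1) + 2)`.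
  rw [hdh, hlh, resultant_ccgPoly_derivative hD hm4, hc1] at hS
  -- Step 3: an irreducible `f(g)` of degree `9 deg g > 1` has no root in `𝔽₃`.
  have hroot : ∀ a : ZMod 3, (ccgPoly.eval g).eval a ≠ 0 := fun a h0 => by
    have h1 := degree_eq_one_of_irreducible_of_root hirr h0
    rw [degree_eq_natDegree hirr.ne_zero, hdh] at h1
    norm_cast at h1
    omega
  have h1 := hroot 1
  have h2 := hroot 2
  rw [ccgPoly_eval_eval_one] at h1
  rw [ccgPoly_eval_eval_two] at h2
  revert hS h1 h2
  generalize g.eval 1 = a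
  generalize g.eval 2 = b
  revert a b
  decide


/-! ### Barrier audit 2026-08-16 (D-0021): the narrowed record and its proof -/

namespace FunctionFieldMobiusBias

section StickelbergerEven

variable {E : Type*} [Field E] [Algebra (ZMod 3) E]

/-- Degree `≡ 0 (mod 4)` companion of `prod_roots_eval_derivative`: for a monic irreducible
`h ∈ 𝔽₃[u]` of degree `d ≡ 0 (mod 4)` the product of `h'` over the roots of `h` is `−1` (Frobenius
is now a `d`-cycle with `d` even, an ODD permutation of the roots, so `δ = ∏_{i<j}(γᵢ − γⱼ)`
satisfies `δ³ = −δ`, `δ² = −1`, while `d(d−1)/2` is still even). This is the parity computation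
behind CCG Example 2.5 (`μ(gᵖ + u) = +1` for `4 ∣ deg g`).
[cite: ConradConradGross2008, Theorem 2.3 and (2.5)] [cite: ConradConradGross2008, Example 2.5] -/
theorem prod_roots_eval_derivative_of_four_dvd [IsAlgClosed E] [CharP E 3] {h : (ZMod 3)[X]}
    (hirr : Irreducible h) (hmo : h.Monic) (hd : h.natDegree % 4 = 0) :
    ((h.map (algebraMap (ZMod 3) E)).roots.map
      fun y => eval y (derivative (h.map (algebraMap (ZMod 3) E)))).prod = -1 := by
  classical
  have hd0 : 0 < h.natDegree := natDegree_pos_iff_degree_pos.mpr (degree_pos_of_irreducible hirr)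
  obtain ⟨x, hx⟩ : ∃ x, (h.map (algebraMap (ZMod 3) E)).IsRoot x :=
    IsAlgClosed.exists_root _ (by
      rw [degree_map, degree_eq_natDegree hirr.ne_zero]
      exact_mod_cast (show h.natDegree ≠ 0 by omega))
  set d := h.natDegree with hd_def
  set v : Fin d → E := fun i : Fin d => x ^ 3 ^ i.val with hv
  have hinj : Function.Injective v := fun i j hij =>
    Fin.ext (pow_three_pow_injOn hirr hmo hx i.isLt j.isLt hij)
  have hroots : (h.map (algebraMap (ZMod 3) E)).roots = Finset.univ.val.map v :=
    roots_map_eq hirr hmo hx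
  have hsplit : (h.map (algebraMap (ZMod 3) E)).Splits := IsAlgClosed.splits _
  -- Step 1: the product is `∏ i, ∏ j ≠ i, (v i - v j)`.
  have h1 : ((h.map (algebraMap (ZMod 3) E)).roots.map
      fun y => eval y (derivative (h.map (algebraMap (ZMod 3) E)))).prod =
      ∏ i, ∏ j ∈ ({i}ᶜ : Finset (Fin d)), (v i - v j) := by
    rw [hroots, Multiset.map_map, Finset.prod_map_val]
    refine Finset.prod_congr rfl fun i _ => ?_
    rw [Function.comp_apply, hsplit.eval_root_derivative (hmo.map _)
      (by rw [hroots]; exact Multiset.mem_map_of_mem _ (Finset.mem_val.mpr (Finset.mem_univ _))),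
      hroots, ← Multiset.map_erase v hinj, ← Finset.erase_val, Multiset.map_map,
      Finset.prod_map_val, Finset.compl_eq_univ_sdiff, Finset.sdiff_singleton_eq_erase]
    rfl
  -- Step 2: `∏ i, ∏ j ≠ i, (v i - v j) = (-1)^N * det(V)^2`.
  have h2 : ∏ i, ∏ j ∈ ({i}ᶜ : Finset (Fin d)), (v i - v j) =
      (∏ i : Fin d, ∏ _j ∈ Finset.Ioi i, (-1 : E)) * (Matrix.vandermonde v).det ^ 2 := by
    rw [← Finset.prod_prod_Ioi_mul_eq_prod_prod_off_diag (fun a b => v b - v a),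
      Matrix.det_vandermonde, ← Finset.prod_pow, ← Finset.prod_mul_distrib]
    refine Finset.prod_congr rfl fun i _ => ?_
    rw [← Finset.prod_pow, ← Finset.prod_mul_distrib]
    refine Finset.prod_congr rfl fun j _ => ?_
    ring
  -- Step 3: the sign `(-1)^{d(d-1)/2}` is `+1` (`d ≡ 0 mod 4`).
  have h3 : (∏ i : Fin d, ∏ _j ∈ Finset.Ioi i, (-1 : E)) = 1 := by
    simp_rw [Finset.prod_const, Finset.prod_pow_eq_pow_sum, Fin.card_Ioi]
    have hsum : (∑ i : Fin d, (d - 1 - (i : ℕ))) * 2 = d * (d - 1) := by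
      rw [Fin.sum_univ_eq_sum_range (fun i => d - 1 - i) d, Finset.sum_range_reflect (fun i => i) d,
        Finset.sum_range_id_mul_two]
    have h4 : 4 ∣ d * (d - 1) := Dvd.dvd.mul_right (Nat.dvd_of_mod_eq_zero hd) (d - 1)
    rw [← hsum] at h4
    have heven : Even (∑ i : Fin d, (d - 1 - (i : ℕ))) := by
      obtain ⟨t, ht⟩ := h4
      exact ⟨t, by omega⟩
    exact heven.neg_one_pow
  -- Step 4: `det V` is ANTI-fixed by Frobenius (odd permutation), hence `det(V)^2 = -1`.
  set V := Matrix.vandermonde v with hV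
  have hVne : V.det ≠ 0 := Matrix.det_vandermonde_ne_zero_iff.mpr hinj
  have hperiod : x ^ 3 ^ d = x := pow_three_pow_natDegree hirr hmo hx
  have hV3 : V.det ^ 3 = -V.det := by
    have e1 : V.det ^ 3 = ((frobenius E 3).mapMatrix V).det := by
      rw [← RingHom.map_det, frobenius_def]
    have e2 : (frobenius E 3).mapMatrix V = V.submatrix (finRotate d) id := by
      ext i j
      simp only [hV, RingHom.mapMatrix_apply, Matrix.map_apply, Matrix.vandermonde_apply,
        frobenius_def, Matrix.submatrix_apply, id]
      rw [← pow_mul, mul_comm, pow_mul]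
      congr 1
      simp only [hv]
      rw [finRotate_val]
      split_ifs with hi
      · rw [← pow_mul, ← pow_succ, hi, Nat.sub_add_cancel (by omega), hperiod, pow_zero, pow_one]
      · rw [← pow_mul, ← pow_succ]
    have e3 : (V.submatrix (finRotate d) id).det = -V.det := by
      rw [Matrix.det_permute, sign_finRotate, Odd.neg_one_pow ⟨(d - 1) / 2, by omega⟩]
      simp
    rw [e1, e2, e3]
  have hV2 : V.det ^ 2 = -1 := by
    have : V.det * (V.det ^ 2 + 1) = 0 := by linear_combination hV3
    rcases mul_eq_zero.mp this with h0 | h0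
    · exact absurd h0 hVne
    · exact eq_neg_of_add_eq_zero_left h0
  rw [h1, h2, h3, hV2, one_mul]

end StickelbergerEven

/-- **CCG Example 2.5 at `p = 3`.** For `g ∈ 𝔽₃[u]` with `4 ∣ deg g` and `deg g > 0`, `g³ + u`
is not irreducible in `𝔽₃[u]` (in print: `μ(gᵖ + u) = (−1)ⁿ χ(c)ⁿ χ(−1)^{n(pn−1)/2} = +1` for
`n = deg g ≡ 0 (mod 4)`, over EVERY finite field of odd characteristic `p`, so `Λ ∈ {0, 2}` persists
over all extensions of the constant field (Theorem 6.12) — the bias is not a small-field artefact).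
Proof: `h = g³ + u` has `h′ = 1`; if `h` were irreducible, of degree `3 deg g ≡ 0 (mod 4)`, the
companion parity lemma `prod_roots_eval_derivative_of_four_dvd` applied to its monic associate
`h₁ = c⁻¹h` (`h₁′ = c⁻¹`) would give `(c⁻¹)^{deg h} = −1`, but `deg h` is even and `c² = 1`.
[cite: ConradConradGross2008, Example 2.5] [cite: ConradConradGross2008, Theorem 6.12] -/
theorem not_irreducible_cube_add_X {g : (ZMod 3)[X]} (hn : 0 < g.natDegree)
    (h4 : g.natDegree % 4 = 0) : ¬ Irreducible (g ^ 3 + X) := by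
  classical
  intro hirr
  have hg : g ≠ 0 := ne_zero_of_natDegree_gt hn
  -- degree and leading coefficient of `h = g³ + u`
  have hdeg3 : (g ^ 3).natDegree = 3 * g.natDegree := natDegree_pow _ _
  have hlt : (X : (ZMod 3)[X]).natDegree < (g ^ 3).natDegree := by
    rw [hdeg3, natDegree_X]; omega
  have hdh : (g ^ 3 + X).natDegree = 3 * g.natDegree := by
    rw [natDegree_add_eq_left_of_natDegree_lt hlt, hdeg3]
  -- the monic associate
  set h := g ^ 3 + X with hh_def
  set c := h.leadingCoeff with hc_def
  have hc : c ≠ 0 := leadingCoeff_ne_zero.mpr hirr.ne_zero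
  have hc2 : c⁻¹ ^ 2 = 1 := by
    have := ZMod.pow_card_sub_one_eq_one (inv_ne_zero hc)
    simpa using this
  set h₁ := h * C c⁻¹ with h₁_def
  have hmo : h₁.Monic := monic_mul_leadingCoeff_inv hirr.ne_zero
  have hirr₁ : Irreducible h₁ := (irreducible_mul_leadingCoeff_inv).mpr hirr
  have hd₁ : h₁.natDegree = 3 * g.natDegree := by
    rw [h₁_def, natDegree_mul_C (inv_ne_zero hc), hdh]
  have hd4 : h₁.natDegree % 4 = 0 := by rw [hd₁]; omega
  -- `h₁' = c⁻¹`, a constant: `(g³)' = 3g²g' = 0` in characteristic `3`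
  have h3 : ((3 : ℕ) : (ZMod 3)[X]) = 0 := by
    have : ((3 : ℕ) : ZMod 3) = 0 := by decide
    rw [← map_natCast C 3, this, map_zero]
  have hder0 : derivative (g ^ 3 + X : (ZMod 3)[X]) = 1 := by
    rw [derivative_add, derivative_X, derivative_pow, map_natCast, h3, zero_mul, zero_mul, zero_add]
  have hder : derivative h₁ = C c⁻¹ := by
    rw [h₁_def, derivative_mul, derivative_C, mul_zero, add_zero, hh_def, hder0, one_mul]
  -- pass to the algebraic closure and apply the parity lemma
  let E := AlgebraicClosure (ZMod 3)
  have key := prod_roots_eval_derivative_of_four_dvd (E := E) hirr₁ hmo hd4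
  obtain ⟨x, hx⟩ : ∃ x, (h₁.map (algebraMap (ZMod 3) E)).IsRoot x :=
    IsAlgClosed.exists_root _ (by
      rw [degree_map, degree_eq_natDegree hirr₁.ne_zero]
      exact_mod_cast (show h₁.natDegree ≠ 0 by omega))
  rw [roots_map_eq hirr₁ hmo hx, derivative_map, hder, map_C, Multiset.map_map] at key
  have hconst : ((Finset.univ : Finset (Fin h₁.natDegree)).val.map
      ((fun y => eval y (C ((algebraMap (ZMod 3) E) c⁻¹))) ∘ fun i : Fin h₁.natDegree =>
        x ^ 3 ^ i.val)).prod = (algebraMap (ZMod 3) E) c⁻¹ ^ h₁.natDegree := by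
    simp
  rw [hconst] at key
  -- `(c⁻¹)^{deg h₁} = 1` since `deg h₁ = 3 deg g` is even and `c⁻² = 1`
  have hone : (algebraMap (ZMod 3) E) c⁻¹ ^ h₁.natDegree = 1 := by
    obtain ⟨k, hk⟩ : ∃ k, h₁.natDegree = 2 * k := ⟨h₁.natDegree / 2, by omega⟩
    rw [← map_pow, hk, pow_mul, hc2, one_pow, map_one]
  rw [hone] at key
  -- `1 = -1` is impossible in characteristic `3`
  have h2 : (2 : E) = 0 := by linear_combination key
  have : ((2 : ℕ) : E) ≠ 0 := by
    rw [Ne, CharP.cast_eq_zero_iff E 3]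
    decide
  exact this (by exact_mod_cast h2)

/-- The CCG polynomial is INSEPARABLE in `T`: `∂_T f = 0` (`f ∈ 𝔽₃[u][T³]`). This is the hypothesis
`f ∈ κ[u][Tᵖ]` of CCG Theorem 4.8 that carries the whole obstruction ("the importance of `f(T)`
being a polynomial in `Tᵖ` is that `∂ᵤ(f(u, g(u))) = (∂ᵤf)(u, g(u))` … has no dependence on
`g′(u)`"). [cite: ConradConradGross2008, Theorem 4.8 (proof, first paragraph)]
[cite: ConradConradGross2008, Example 1.2] -/
theorem derivative_ccgPoly : derivative ccgPoly = 0 := by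
  have h9 : ((9 : ℕ) : (ZMod 3)[X][X]) = 0 := by
    rw [← map_natCast C 9, ← map_natCast C 9, show ((9 : ℕ) : ZMod 3) = 0 by decide, map_zero,
      map_zero]
  have h6 : ((6 : ℕ) : (ZMod 3)[X][X]) = 0 := by
    rw [← map_natCast C 6, ← map_natCast C 6, show ((6 : ℕ) : ZMod 3) = 0 by decide, map_zero,
      map_zero]
  have h3 : ((3 : ℕ) : (ZMod 3)[X][X]) = 0 := by
    rw [← map_natCast C 3, ← map_natCast C 3, show ((3 : ℕ) : ZMod 3) = 0 by decide, map_zero,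
      map_zero]
  simp only [ccgPoly, derivative_add, derivative_mul, derivative_C, derivative_X_pow, map_natCast,
    h9, h6, h3, zero_mul, mul_zero, add_zero]

/-- Likewise `T³ + u ∈ 𝔽₃[u][T³]` (Example 2.5 at `p = 3`) is inseparable in `T`.
[cite: ConradConradGross2008, Example 2.5] -/
theorem derivative_cube_add_u : derivative (X ^ 3 + C X : (ZMod 3)[X][X]) = 0 := by
  have h3 : ((3 : ℕ) : (ZMod 3)[X][X]) = 0 := by
    rw [← map_natCast C 3, ← map_natCast C 3, show ((3 : ℕ) : ZMod 3) = 0 by decide, map_zero,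
      map_zero]
  rw [derivative_add, derivative_C, derivative_X_pow, map_natCast, h3, zero_mul, add_zero]

/-- The literal analogue of Hardy–Littlewood's Conjecture E polynomial, `T² + 1`, is never an
inseparable irreducible — over ANY integral domain of coefficients (so in particular over every
`κ[u]`): if `T² + 1` is irreducible then `∂_T(T² + 1) = 2T ≠ 0` (were `2 = 0`, one would have
`T² + 1 = (T + 1)²`, reducible). Hence CCG's Möbius periodicity (Theorem 4.8, hypothesis
`f ∈ κ[u][Tᵖ]`) never applies to the `κ[u]`-analogue of `n² + 1`; on the contrary the naive
Bateman–Horn asymptotic for `g² + 1` over `𝔽_q[u]` is a theorem for `q` odd, `q > 2¹⁰3²e²p⁴`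
(Sawin–Shusterman 2022, Theorem 1.2, `deg_T F = 2`). [folklore]
[cite: SawinShusterman2022, Theorem 1.2] -/
theorem derivative_ne_zero_of_irreducible_X_sq_add_one {R : Type*} [CommRing R] [IsDomain R]
    (hirr : Irreducible (X ^ 2 + 1 : R[X])) : derivative (X ^ 2 + 1 : R[X]) ≠ 0 := by
  intro h0
  have hd : derivative (X ^ 2 + 1 : R[X]) = C (2 : R) * X := by
    rw [derivative_add, derivative_one, add_zero, derivative_X_pow]
    norm_num
  have h2 : (2 : R) = 0 := by
    have := congr_arg (fun p : R[X] => p.coeff 1) (hd.symm.trans h0)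
    simpa using this
  have hsq : (X ^ 2 + 1 : R[X]) = (X + C 1) * (X + C 1) := by
    have e : (X + C 1 : R[X]) * (X + C 1) = X ^ 2 + 1 + C (2 : R) * X := by
      rw [map_one, show (C (2 : R) : R[X]) = 2 from map_ofNat C 2]
      ring
    rw [e, h2, map_zero, zero_mul, add_zero]
  have hu : IsUnit (X + C 1 : R[X]) := (hirr.isUnit_or_isUnit hsq).elim id id
  have := natDegree_eq_zero_of_isUnit hu
  rw [natDegree_X_add_C] at this
  exact one_ne_zero this

end FunctionFieldMobiusBias


/-- **Möbius (parity) bias of Bateman–Horn over `κ[u]` — NARROWED companion record** (barrier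
audit of this proof file, 2026-08-16, D-0021). The catalogued entry `FunctionFieldMobiusBias`
(Conrad–Conrad–Gross 2008, Example 6.10) is TRUE — proved above — and its block was confirmed and
sharpened by the same day's audit of the definitions file (technique class `verbatim-transfer`,
evasions (b)–(c): Entin 2016, Sawin–Shusterman 2018/2022). This record adds what that block leaves
implicit and PROVES it (`FunctionFieldMobiusBiasNarrow_holds`). (1) Two kernel-checked instances
over `𝔽₃[u]`: (1a) the parent fact `FunctionFieldMobiusBias` itself (Example 6.10: `ccgPoly(g)`
composite whenever `deg g ≡ 1 (mod 4)`) and (1b) Example 2.5 at `p = 3` (`g³ + u` composite whenever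
`4 ∣ deg g`, `deg g > 0`) — the latter is the NON-generic family `αTᵖ + (βu + γ)` of Theorem 6.12 whose correction factor is RIGID,
`λ_{κ′}(f; c) = 1 − χ_{κ′}(−1)^{c/2} ∈ {0, 2}` for even `c` over every finite extension `κ′` (in print
`μ(gᵖ + u) = (−1)ⁿχ(c)ⁿχ(−1)^{n(pn−1)/2} = +1` for `4 ∣ n`, over every `𝔽_q` with `q` odd): the
obstruction is not only a small-field effect (the parent entry's scope caveat (b) describes the
generic case). (2) Both obstructed polynomials are INSEPARABLE in `T`, `∂_T f = 0` — the one
hypothesis of Theorem 4.8 (`f ∈ κ[u][Tᵖ]`), used in its proof only through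
`(f(g))′ = (∂ᵤf)(g)` ("no dependence on `g′(u)`"); this is what no irreducible `f ∈ ℤ[T]` and no
literal `κ[u]`-analogue of a fixed separable instance shares. (3) `T² + 1` — the analogue of the
Hardy–Littlewood polynomial `n² + 1` (problem E of *Partitio Numerorum* III) — is never an
inseparable irreducible over ANY integral domain of coefficients (`2T = 0` forces
`T² + 1 = (T + 1)²`); so the parent `blocks:` line bites the `k = 1` target
`Literature.NumberTheory.Sieve.HardyLittlewoodConjE` only through `f`-UNIFORM arguments, while
the literal `𝔽_q[u]`-analogue of that target (prime values of `g² + 1`, `q ≡ 3 (mod 4)`) is an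
instance of Sawin–Shusterman's quadratic theorem and hence TRUE for `q = p^{2j+1}`, `p ≡ 3 (mod 4)`,
`q > 2¹⁰3²e²p⁴`. [cite: ConradConradGross2008, Example 2.5] [cite: ConradConradGross2008, Example 6.10]
[cite: ConradConradGross2008, Theorem 4.8 (statement and first paragraph of the proof)]
[cite: ConradConradGross2008, Theorem 6.12 and the paragraph after it]
[cite: SawinShusterman2022, Theorem 1.2] [cite: Entin2016, Theorem 1.1]

BARRIER (D-0021; one line per key):
technique_class: bateman-horn-heuristic random-model moebius-randomness verbatim-transfer inseparable-specialization f-uniform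
blocks: exactly the `f`-UNIFORM arguments of the parent entry `FunctionFieldMobiusBias` — a derivation of the summit statement `_root_.BatemanHorn` (equivalently of `Literature.NumberTheory.Sieve.BatemanHornAsymptotic f` for generic `f`) every step of which holds verbatim for EVERY prime `f ∈ κ[u][T]` without local obstruction over a finite field `κ`, inseparable ones included, is wrong, because its conclusion fails for `f = ccgPoly` over `𝔽₃[u]` in degrees `≡ 1 (mod 4)` (conjunct (1a)) and for `f = T³ + u` over `𝔽₃[u]` in degrees `≡ 0 (mod 4)` (conjunct (1b); in print `Tᵖ + u` over every `𝔽_q`, `q` odd, Example 2.5), while in characteristic `2` even the qualitative Bouniakowsky–Schinzel statement fails (`g⁸ + u³` is reducible for every `g ∈ 𝔽₂[u]`: Swan 1962, p. 1102; the Schinzel hypothesis for a polynomial ring `R[u]` is proved only when `Frac R` is imperfect-Hilbertian, in particular infinite — Bodin–Dèbes–Najib 2020, §1.2, citing Swan's example for `R = 𝔽₂`) [cite: ConradConradGross2008, Example 2.5] [cite: ConradConradGross2008, Example 6.10] [cite: Swan1962, p. 1102 (Example)] [cite: BodinDebesNajib2020, §1.2]. NOT blocked: (a) any argument using an input that fails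 for some irreducible inseparable `f` — over `ℤ` every irreducible `f` supplies such inputs for free (`f′ ≠ 0`, `disc_T f ≠ 0`, `deg f · lead f ≠ 0` for Weyl differencing, simple roots modulo all but finitely many primes), cf. the parent entry's litmus-test sentence; (b) any `f`-SPECIFIC derivation of a `k = 1` target whose literal analogue is separable — for `Literature.NumberTheory.Sieve.HardyLittlewoodConjE`, `T² + 1` is separable in odd characteristic and `(T + 1)²` in characteristic `2` (conjunct (3)), and the naive `𝔽_q[u]`-asymptotic for prime values of `g² + 1` (monic `g`, `q ≡ 3 (mod 4)`) is a THEOREM for `q > 2¹⁰3²e²p⁴` (Sawin–Shusterman 2022, Theorem 1.2: every irreducible monic `F` with `deg_T F = 2`, `p` odd) — nothing specific to `n² + 1` can be refuted by this entry [cite: SawinShusterman2022, Theorem 1.2]; (c) the local-density / singular-series INPUTS themselves, which are correct also for inseparable `f` — `C(f)` enters CCG's corrected prediction (6.3) unchanged; what fails is their sufficiency [cite: ConradConradGross2008, §6 (6.1)–(6.3)].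
because: the load-bearing input that fails for inseparable `f` is Möbius cancellation along the values: by (2.5), `μ(h) = (−1)^{deg h} χ(disc h)`, and `(f(g))′ = (∂ᵤf)(g)` for `f ∈ κ[u][Tᵖ]`, `disc f(g)` is a resultant quasi-periodic in `g`, so `μ(f(g))` is a deterministic function of (`g mod M`, `deg g mod 4`, `χ(lead g)`) (Theorem 4.8) and the restricted Möbius average `1 − Λ_κ(f; n)` is eventually periodic instead of `o(1)` (Theorem 6.5) [cite: ConradConradGross2008, Theorem 4.8] [cite: ConradConradGross2008, Theorem 6.5]; conjunct (1b) is the extreme case `M = 1`: `(g³ + u)′ = 1`, `disc` depends on (`deg g mod 4`, `χ(lead g)`) alone, and for `4 ∣ deg g` an irreducible `g³ + u` would contradict the Stickelberger–Swan parity `∏ h′(γᵢ) = −1` for irreducible `h` of degree `≡ 0 (mod 4)` over `𝔽₃` (`prod_roots_eval_derivative_of_four_dvd`: Frobenius is an odd permutation of the roots) [cite: ConradConradGross2008, Theorem 2.3 and (2.5)]; for SEPARABLE `F` the same formula is the engine of the evasion — `χ(disc F(g))` along fixed-derivative families is a short character sum with cancellation, `∑_{|g| ≤ X} μ(F(g))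 = o(X)` for `F` separable of degree `k`, `p` odd, `q > 4e²k²p²` (parent entry, evasions (b)–(c)) [cite: SawinShusterman2022, Theorem 1.3]. The entry is thus the function-field certificate that the Möbius-cancellation step of a Bateman–Horn derivation cannot be `f`-uniform — nothing more, nothing less.
evasions_known: as in the parent entry — separability via monodromy/Chebotarev as `q → ∞` (Entin 2016, Theorem 1.1, all separable systems, error `O_{n, deg F}(q^{−1/2})`) [cite: Entin2016, Theorem 1.1], Pellet's formula plus short sums of trace functions at fixed `q` large relative to `p` (Sawin–Shusterman 2022, Theorems 1.2–1.3) [cite: SawinShusterman2022, Theorems 1.2 and 1.3], and for inseparable `f` the correction factor `Λ_κ(f; n)` of (6.3) (period `1, 2, 4`, Theorem 6.5; `λ_{κ′} → 1` or `∈ {0, 2}` under constant-field extension, Theorem 6.12) [cite: ConradConradGross2008, Theorem 6.12]; on the qualitative side (infinitely many prime values), rings `R[u]` with `Frac R` imperfect-Hilbertian (Bodin–Dèbes–Najib 2020) [cite: BodinDebesNajib2020, §1.2].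
scope_caveats: everything here is about `κ[u]`: over `ℤ` there is no inseparable irreducible `f` and "no known analogue" of (2.5), so NO `ℤ`-statement is refuted [cite: ConradConradGross2008, §2 (after Definition 2.1)]; conjunct (1) is proved over `𝔽₃` only (print: Example 2.5 for all odd `q` and all `n ≡ 0 (mod 4)`, `n ≥ 1`; Example 6.10 for `q = 3^m` through `Λ_{𝔽_{3^m}}`, prime-free degrees over `𝔽₃` only); characteristic `2` (Swan's `T⁸ + u³`; periodicity only for `f ∈ κ[u][T⁴]`, Theorem 5.12; none visible for `T² + u`) is quoted, not transcribed [cite: ConradConradGross2008, Theorem 5.12]; the positive separable-side theorems hold for `q → ∞` or `q` large relative to `p` and count monic `g` (cf. Remark 6.11 on monic sampling) — at fixed small `q` (e.g. `g² + 1` over `𝔽₃[u]`) the naive analogue is neither proved nor refuted [cite: ConradConradGross2008, Remark 6.11].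
status: established (proved in tree: `FunctionFieldMobiusBiasNarrow_holds`, this file) -/
def FunctionFieldMobiusBiasNarrow : Prop :=
  FunctionFieldMobiusBias ∧
  (∀ g : Polynomial (ZMod 3), 0 < g.natDegree → g.natDegree % 4 = 0 → ¬ Irreducible (g ^ 3 + X)) ∧
  Polynomial.derivative ccgPoly = 0 ∧
  Polynomial.derivative (X ^ 3 + C X : Polynomial (Polynomial (ZMod 3))) = 0 ∧
  ∀ (R : Type) [CommRing R] [IsDomain R],
    Irreducible (X ^ 2 + 1 : Polynomial R) → Polynomial.derivative (X ^ 2 + 1 : Polynomial R) ≠ 0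

open FunctionFieldMobiusBias in
/-- The narrowed record holds: CCG Example 6.10 (`FunctionFieldMobiusBias_holds`), Example 2.5 at
`p = 3` (`not_irreducible_cube_add_X`, via the degree-`≡ 0 (mod 4)` Stickelberger–Swan parity
`prod_roots_eval_derivative_of_four_dvd`), inseparability of both polynomials
(`derivative_ccgPoly`, `derivative_cube_add_u`) and separability-or-reducibility of `T² + 1`
(`derivative_ne_zero_of_irreducible_X_sq_add_one`). [cite: ConradConradGross2008, Example 6.10]
[cite: ConradConradGross2008, Example 2.5] -/
theorem FunctionFieldMobiusBiasNarrow_holds : FunctionFieldMobiusBiasNarrow :=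
  ⟨FunctionFieldMobiusBias_holds, fun _ hn h4 => not_irreducible_cube_add_X hn h4,
    derivative_ccgPoly, derivative_cube_add_u,
    fun _ _ _ h => derivative_ne_zero_of_irreducible_X_sq_add_one h⟩

end Literature.Barriers.Parity
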